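import Mathlib.Algebra.MvPolynomial.Funext
import Mathlib.Algebra.Polynomial.Roots
import Literature.NumberTheory.Automorphic.ProjectiveElimination
import Literature.NumberTheory.Automorphic.ZariskiGLProducts
import HarnessLib

/-!
# Closed cones in `kⁿ`, closed orbits in projective space, and the finiteness lemma
(trunk T-AUTOMORPHIC, G25 AutomorphicL; Springer 2.3.3 (ii), 6.1–6.2)

Projective geometry on `k`-points, phrased through *cones* in affine space `kⁿ = (ι → k)` with its
Zariski topology (`zariskiTopologyPi`, `ZariskiAffineSpace.lean`): a subset of `ℙ(kⁿ)` "is" a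
cone (a subset stable under the non-zero scalars, `IsConeSet`), a closed subset of `ℙ(kⁿ)` is a
closed cone, the orbit `G · [v]` of a line under a subgroup `G ≤ GL n k` is the *orbit cone*
`orbitCone G v = {c · g v}`. This avoids quotient varieties altogether. Proved here:

* cones: non-empty closed cones contain `0` and are cut out by *homogeneous* polynomials
  (`IsConeSet.exists_homogeneous_eq`, over an infinite field); closures of cones are cones;
  scalings and the matrices `g ∈ GL n k` act by homeomorphisms (`smulHomeomorph`,
  `mulVecHomeomorph`);
* `isClosed_setOf_exists_common_zero_set` — the elimination theorem of
  `ProjectiveElimination.lean` (Springer 6.1.3: `ℙⁿ × kᵐ → kᵐ` is closed) for an arbitrary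
  *set* of `X`-homogeneous equations (Noetherian reduction to the finite case);
* **`IsConeSet.finite_sep_dotProduct_eq_one` (finiteness lemma)** — if a closed cone `D` meets
  the hyperplane `ℓ = 0` only in `0`, then `D ∩ {ℓ = 1}` is finite (Springer 6.1.2 (vi)/6.1.5:
  a closed subvariety of `ℙⁿ` contained in an affine chart, being complete and affine, is
  finite); the proof eliminates `x` from `p xᵢ = q ℓ(x), x ∈ D` and reads off that each
  coordinate takes finitely many values;
* line stabilisers `lineStabilizer G v` are algebraic subgroups (`isAlgebraicSubgroup_lineStabilizer`);
* **`exists_isClosed_orbitCone` — closed orbits exist (Springer 2.3.3 (ii) for the action of an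
  algebraic `G ≤ GL n k` on `ℙ(kⁿ)`)**: every closed `G`-stable cone containing a non-zero
  vector contains a `v ≠ 0` whose orbit cone is closed. Proof: a minimal closed `G`-stable cone
  (Noetherian induction) is the closure of each of its punctured orbit cones, which by
  Chevalley's theorem (`exists_isOpen_inter_closure_image_subset`) contain open pieces of it,
  hence all coincide.

These are the inputs of Borel's fixed point theorem (`BorelFixedPoint.lean`) and of the
conjugacy of Borel subgroups (`BorelConjugacy.lean`, Springer 6.2.7 (iii)).

## References

* T. A. Springer, *Linear Algebraic Groups*, 2nd ed., Progress in Mathematics 9, Birkhäuser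
  (1998), 1.9.5, 2.3.3, 6.1.2–6.1.5 [SpringerLAG1998].
-/

noncomputable section

open MvPolynomial Matrix

namespace Literature.NumberTheory.Automorphic

variable {k : Type*} [Field k] {ι : Type*} [Fintype ι] [DecidableEq ι]

attribute [local instance] zariskiTopologyPi zariskiTopologyGL

/-! ### Cones -/

section Cones

/-- A *cone* in `kⁿ`: a subset stable under multiplication by non-zero scalars (the affine
trace of a subset of projective space; `0` may or may not belong to it). [folklore] -/
def IsConeSet (C : Set (ι → k)) : Prop :=
  ∀ c : k, c ≠ 0 → ∀ v ∈ C, c • v ∈ C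

omit [Fintype ι] [DecidableEq ι] in
/-- Intersections of cones are cones. [folklore] -/
theorem IsConeSet.inter {C D : Set (ι → k)} (hC : IsConeSet C) (hD : IsConeSet D) :
    IsConeSet (C ∩ D) :=
  fun c hc _ hv => ⟨hC c hc _ hv.1, hD c hc _ hv.2⟩

omit [Fintype ι] [DecidableEq ι] in
/-- The whole space is a cone. [folklore] -/
theorem isConeSet_univ : IsConeSet (Set.univ : Set (ι → k)) := fun _ _ _ _ => trivial

omit [Fintype ι] [DecidableEq ι] in
/-- A linear subspace is a cone. [folklore] -/
theorem isConeSet_submodule (W : Submodule k (ι → k)) : IsConeSet (W : Set (ι → k)) :=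
  fun c _ _ hv => W.smul_mem c hv

/-- Scaling by a unit is a Zariski homeomorphism of `kⁿ`. [folklore] -/
def smulHomeomorph (c : kˣ) : (ι → k) ≃ₜ (ι → k) where
  toFun v := c • v
  invFun v := c⁻¹ • v
  left_inv v := inv_smul_smul c v
  right_inv v := smul_inv_smul c v
  continuous_toFun :=
    continuous_of_polynomialMap (fun i => C (c : k) * X i) fun v i => by
      simp [Units.smul_def]
  continuous_invFun :=
    continuous_of_polynomialMap (fun i => C ((c⁻¹ : kˣ) : k) * X i) fun v i => by
      simp [Units.smul_def]

omit [Fintype ι] [DecidableEq ι] in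
/-- `smulHomeomorph c v = c • v`. [folklore] -/
@[simp] lemma smulHomeomorph_apply (c : kˣ) (v : ι → k) : smulHomeomorph c v = (c : k) • v := rfl

/-- An invertible matrix acts on `kⁿ` by a Zariski homeomorphism. [folklore] -/
def mulVecHomeomorph (g : GL ι k) : (ι → k) ≃ₜ (ι → k) where
  toFun v := (g : Matrix ι ι k) *ᵥ v
  invFun v := ((g⁻¹ : GL ι k) : Matrix ι ι k) *ᵥ v
  left_inv v := by
    simp [Matrix.mulVec_mulVec]
  right_inv v := by
    simp [Matrix.mulVec_mulVec]
  continuous_toFun :=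
    continuous_of_polynomialMap (fun i => ∑ j, C ((g : Matrix ι ι k) i j) * X j) fun v i => by
      simp [Matrix.mulVec, dotProduct]
  continuous_invFun :=
    continuous_of_polynomialMap (fun i => ∑ j, C (((g⁻¹ : GL ι k) : Matrix ι ι k) i j) * X j)
      fun v i => by simp [Matrix.mulVec, dotProduct]

/-- `mulVecHomeomorph g v = g v`. [folklore] -/
@[simp] lemma mulVecHomeomorph_apply (g : GL ι k) (v : ι → k) :
    mulVecHomeomorph g v = (g : Matrix ι ι k) *ᵥ v := rfl

omit [Fintype ι] [DecidableEq ι] in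
/-- The closure of a cone is a cone. [folklore] -/
theorem isConeSet_closure {C : Set (ι → k)} (hC : IsConeSet C) : IsConeSet (closure C) := by
  intro c hc v hv
  have h := (smulHomeomorph (Units.mk0 c hc)).image_closure C
  have hsub : (smulHomeomorph (Units.mk0 c hc)) '' C ⊆ C := by
    rintro _ ⟨w, hw, rfl⟩
    exact hC c hc w hw
  have : c • v ∈ (smulHomeomorph (Units.mk0 c hc)) '' closure C := ⟨v, hv, rfl⟩
  rw [h] at this
  exact closure_mono hsub this

/-- If `C` is stable under `g ∈ GL n k` then so is its closure. [folklore] -/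
theorem mulVec_mem_closure_of_forall {C : Set (ι → k)} {g : GL ι k}
    (hg : ∀ v ∈ C, (g : Matrix ι ι k) *ᵥ v ∈ C) {v : ι → k} (hv : v ∈ closure C) :
    (g : Matrix ι ι k) *ᵥ v ∈ closure C := by
  have h := (mulVecHomeomorph g).image_closure C
  have hsub : (mulVecHomeomorph g) '' C ⊆ C := by
    rintro _ ⟨w, hw, rfl⟩
    exact hg w hw
  have : (g : Matrix ι ι k) *ᵥ v ∈ (mulVecHomeomorph g) '' closure C := ⟨v, hv, rfl⟩
  rw [h] at this
  exact closure_mono hsub this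

omit [DecidableEq ι] in
/-- Evaluating a homogeneous polynomial of degree `d` at `c • v` multiplies the value by `c ^ d`.
[folklore] -/
theorem eval_smul_of_isHomogeneous {p : MvPolynomial ι k} {d : ℕ} (hp : p.IsHomogeneous d) (c : k)
    (v : ι → k) : eval (c • v) p = c ^ d * eval v p := by
  rw [eval_eq', eval_eq', Finset.mul_sum]
  refine Finset.sum_congr rfl fun s hs => ?_
  have hdeg : ∑ i, s i = d := by
    have h := hp (mem_support_iff.1 hs)
    rw [← h, Finsupp.weight_apply]
    simp [Finsupp.sum_fintype]
  have : ∏ i, (c • v) i ^ s i = c ^ d * ∏ i, v i ^ s i := by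
    simp only [Pi.smul_apply, smul_eq_mul, mul_pow]
    rw [Finset.prod_mul_distrib, Finset.prod_pow_eq_pow_sum, hdeg]
  rw [this]
  ring

omit [DecidableEq ι] in
/-- A polynomial vanishing on all non-zero multiples of `v` (over an infinite field) has all its
homogeneous components vanishing at `v`. [folklore] -/
theorem eval_homogeneousComponent_eq_zero_of_forall_smul [Infinite k] {p : MvPolynomial ι k}
    {v : ι → k} (h : ∀ c : k, c ≠ 0 → eval (c • v) p = 0) (d : ℕ) :
    eval v (homogeneousComponent d p) = 0 := by
  classical
  -- the univariate polynomial `c ↦ p (c • v)`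
  set P : Polynomial k :=
    ∑ e ∈ Finset.range (p.totalDegree + 1), Polynomial.monomial e (eval v (homogeneousComponent e p))
    with hP
  have hPeval : ∀ c : k, P.eval c = eval (c • v) p := by
    intro c
    conv_rhs => rw [← sum_homogeneousComponent p]
    rw [hP, Polynomial.eval_finsetSum, map_sum]
    refine Finset.sum_congr rfl fun e _ => ?_
    rw [Polynomial.eval_monomial,
      eval_smul_of_isHomogeneous (homogeneousComponent_isHomogeneous e p), mul_comm]
  have hP0 : P = 0 := by
    apply Polynomial.eq_zero_of_infinite_isRoot
    refine Set.Infinite.mono (s := {c : k | c ≠ 0}) (fun c hc => ?_) ?_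
    · rw [Set.mem_setOf_eq, Polynomial.IsRoot, hPeval]
      exact h c hc
    · exact (Set.finite_singleton (0 : k)).infinite_compl
  by_cases hd : d < p.totalDegree + 1
  · have hcoeff : P.coeff d = eval v (homogeneousComponent d p) := by
      rw [hP, Polynomial.finsetSum_coeff]
      simp only [Polynomial.coeff_monomial]
      rw [Finset.sum_ite_eq', if_pos (Finset.mem_range.2 hd)]
    rw [← hcoeff, hP0, Polynomial.coeff_zero]
  · rw [homogeneousComponent_eq_zero _ _ (by omega), map_zero]

omit [DecidableEq ι] in
/-- **Closed cones are cut out by homogeneous polynomials** (over an infinite field): a closed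
cone is the set of common zeros of a set of homogeneous polynomials, namely the homogeneous
components of the polynomials vanishing on it. [folklore] -/
theorem IsConeSet.exists_homogeneous_eq [Infinite k] {C : Set (ι → k)} (hC : IsConeSet C)
    (hcl : IsClosed C) :
    ∃ S : Set (MvPolynomial ι k), (∀ q ∈ S, ∃ d, q.IsHomogeneous d) ∧
      C = {v | ∀ q ∈ S, eval v q = 0} := by
  obtain ⟨S₀, rfl⟩ := isClosed_iff_exists_setOf_eval.1 hcl
  refine ⟨{q | ∃ p ∈ S₀, ∃ d, q = homogeneousComponent d p}, ?_, ?_⟩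
  · rintro _ ⟨p, _, d, rfl⟩
    exact ⟨d, homogeneousComponent_isHomogeneous d p⟩
  · ext v
    simp only [Set.mem_setOf_eq]
    constructor
    · rintro hv _ ⟨p, hp, d, rfl⟩
      refine eval_homogeneousComponent_eq_zero_of_forall_smul (fun c hc => ?_) d
      exact hC c hc v hv p hp
    · intro hv p hp
      rw [← sum_homogeneousComponent p, map_sum]
      exact Finset.sum_eq_zero fun d _ => hv _ ⟨p, hp, d, rfl⟩

omit [DecidableEq ι] in
/-- A non-empty closed cone contains `0` (over an infinite field). [folklore] -/
theorem IsConeSet.zero_mem [Infinite k] {C : Set (ι → k)} (hC : IsConeSet C) (hcl : IsClosed C)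
    (hne : C.Nonempty) : (0 : ι → k) ∈ C := by
  obtain ⟨S, hS, rfl⟩ := hC.exists_homogeneous_eq hcl
  obtain ⟨v, hv⟩ := hne
  intro q hq
  obtain ⟨d, hd⟩ := hS q hq
  rcases Nat.eq_zero_or_pos d with rfl | hdpos
  · -- a homogeneous polynomial of degree `0` is a constant, determined by its value at `v`
    have h1 : eval (0 : ι → k) q = eval ((0 : k) • v) q := by rw [zero_smul]
    rw [h1, eval_smul_of_isHomogeneous hd, pow_zero, one_mul]
    exact hv q hq
  · have h1 : eval (0 : ι → k) q = eval ((0 : k) • v) q := by rw [zero_smul]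
    rw [h1, eval_smul_of_isHomogeneous hd, zero_pow hdpos.ne', zero_mul]

end Cones

/-! ### The elimination theorem for a set of equations -/

section Elimination

variable {σ : Type*}

/-- **Elimination for an arbitrary set of `X`-homogeneous equations** (Springer 6.1.3 on
`k`-points): for a set `S ⊆ k[y][X]` of polynomials homogeneous in `X` over an algebraically
closed field, `{y | the f (y, ·), f ∈ S, have a common zero x ≠ 0}` is Zariski closed. Reduction
to the finite case `isClosed_setOf_exists_common_zero`: by Noetherian induction on the closed
sets `{x | f (y, x) = 0, f ∈ F}` (`F ⊆ S` finite) the locus is the intersection of the loci of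
the finite subfamilies. [cite: SpringerLAG1998, 6.1.3] -/
theorem isClosed_setOf_exists_common_zero_set [IsAlgClosed k]
    {S : Set (MvPolynomial ι (MvPolynomial σ k))} (hS : ∀ f ∈ S, ∃ d, f.IsHomogeneous d) :
    IsClosed {y : σ → k | ∃ x : ι → k, x ≠ 0 ∧ ∀ f ∈ S, eval x (specialize y f) = 0} := by
  classical
  haveI := noetherianSpace_pi (σ := ι) (k := k)
  -- the locus of a finite subfamily is closed
  have hfin : ∀ F : Finset (MvPolynomial ι (MvPolynomial σ k)), ↑F ⊆ S →
      IsClosed {y : σ → k | ∃ x : ι → k, x ≠ 0 ∧ ∀ f ∈ F, eval x (specialize y f) = 0} := by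
    intro F hF
    choose d hd using fun f : ↥F => hS f (hF f.2)
    let e := F.equivFin
    have h := isClosed_setOf_exists_common_zero (k := k) (ι := ι) (σ := σ)
      (fun j : Fin F.card => ((e.symm j : ↥F) : MvPolynomial ι (MvPolynomial σ k)))
      (d := fun j => d (e.symm j)) (fun j => hd (e.symm j))
    convert h using 1
    ext y
    simp only [Set.mem_setOf_eq]
    refine exists_congr fun x => and_congr Iff.rfl ⟨fun hx j => hx _ (e.symm j).2, fun hx f hf => ?_⟩
    have := hx (e ⟨f, hf⟩)
    simpa using this
  -- the locus is the intersection over the finite subfamilies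
  have e : {y : σ → k | ∃ x : ι → k, x ≠ 0 ∧ ∀ f ∈ S, eval x (specialize y f) = 0} =
      ⋂ F : {F : Finset (MvPolynomial ι (MvPolynomial σ k)) // ↑F ⊆ S},
        {y : σ → k | ∃ x : ι → k, x ≠ 0 ∧ ∀ f ∈ F.1, eval x (specialize y f) = 0} := by
    ext y
    simp only [Set.mem_setOf_eq, Set.mem_iInter, Subtype.forall]
    constructor
    · rintro ⟨x, hx0, hx⟩ F hF
      exact ⟨x, hx0, fun f hf => hx f (hF hf)⟩
    · intro h
      -- Noetherian induction on the closed sets `Z F`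
      let Z : {F : Finset (MvPolynomial ι (MvPolynomial σ k)) // ↑F ⊆ S} →
          TopologicalSpace.Closeds (ι → k) := fun F =>
        ⟨{x | ∀ f ∈ F.1, eval x (specialize y f) = 0}, by
          have : {x : ι → k | ∀ f ∈ F.1, eval x (specialize y f) = 0} =
              {x | ∀ p ∈ (fun f => specialize y f) '' (F.1 : Set _), eval x p = 0} := by
            ext x; simp
          rw [this]
          exact isClosed_setOf_forall_eval_eq_zero _⟩
      haveI : Nonempty {F : Finset (MvPolynomial ι (MvPolynomial σ k)) // ↑F ⊆ S} :=
        ⟨⟨∅, by simp⟩⟩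
      obtain ⟨A, ⟨F₀, rfl⟩, hmin⟩ :=
        (wellFounded_lt (α := TopologicalSpace.Closeds (ι → k))).has_min
          (Set.range Z) (Set.range_nonempty Z)
      obtain ⟨x₀, hx₀, hx₀Z⟩ := h F₀.1 F₀.2
      refine ⟨x₀, hx₀, fun f hf => ?_⟩
      let F₁ : {F : Finset (MvPolynomial ι (MvPolynomial σ k)) // ↑F ⊆ S} :=
        ⟨insert f F₀.1, by
          rw [Finset.coe_insert]
          exact Set.insert_subset hf F₀.2⟩
      have hle : Z F₁ ≤ Z F₀ := fun x hx g hg => hx g (Finset.mem_insert_of_mem hg)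
      have heq : Z F₁ = Z F₀ := by
        by_contra hne
        exact hmin (Z F₁) ⟨F₁, rfl⟩ (lt_of_le_of_ne hle hne)
      have hx₀Z' : x₀ ∈ (Z F₀ : Set (ι → k)) := hx₀Z
      rw [← heq] at hx₀Z'
      exact hx₀Z' f (Finset.mem_insert_self f _)
  rw [e]
  exact isClosed_iInter fun F => hfin F.1 F.2

end Elimination

/-! ### The finiteness lemma: a closed cone off a hyperplane has finite affine trace -/

section Finiteness

variable [IsAlgClosed k]

/-- **Finiteness lemma** (Springer 6.1.2 (vi) with 6.1.3/6.1.5: a closed subvariety of `ℙⁿ`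
lying in an affine chart is complete and affine, hence finite). Cone form: if a closed cone
`D ⊆ kⁿ` meets the hyperplane `a · x = 0` only in `0`, then `D ∩ {a · x = 1}` is finite. Proof:
for each coordinate `i`, eliminating `x` from "`x ∈ D`, `x ≠ 0`, `p xᵢ = q (a · x)`" gives a
closed set of parameters `(p, q) ∈ k²` (`isClosed_setOf_exists_common_zero_set`) containing
`(1, wᵢ)` for `w ∈ D ∩ {a · x = 1}` but not `(0, 1)`; a closed subset of `k²` stable under
scalars and containing `(1, s)` for infinitely many `s` contains `(0, 1)` (polynomial identity
over the infinite field `k`), so each coordinate takes finitely many values on `D ∩ {a · x = 1}`.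
[cite: SpringerLAG1998, 6.1.2 (vi)] -/
theorem IsConeSet.finite_sep_dotProduct_eq_one {D : Set (ι → k)} (hD : IsConeSet D)
    (hcl : IsClosed D) (a : ι → k) (hker : ∀ w ∈ D, a ⬝ᵥ w = 0 → w = 0) :
    {w ∈ D | a ⬝ᵥ w = 1}.Finite := by
  classical
  -- trivial if `D ⊆ {0}`
  by_cases hD0 : ∀ w ∈ D, w = 0
  · refine (Set.finite_empty).subset ?_
    rintro w ⟨hw, hw1⟩
    have := hD0 w hw
    subst this
    simp at hw1
  push Not at hD0
  obtain ⟨x₀, hx₀D, hx₀⟩ := hD0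
  -- homogeneous equations for `D`
  obtain ⟨S, hShom, hSD⟩ := hD.exists_homogeneous_eq hcl
  have hmemD : ∀ x, x ∈ D ↔ ∀ q ∈ S, eval x q = 0 := fun x => by rw [hSD]; rfl
  -- the linear form as a polynomial
  let L : MvPolynomial ι k := ∑ j, C (a j) * X j
  have hL : ∀ x : ι → k, eval x L = a ⬝ᵥ x := fun x => by
    simp [L, dotProduct, map_sum]
  -- for each coordinate, the parameters `(p, q)` with a solution
  let T : ι → Set (Fin 2 → k) := fun i =>
    {y | ∃ x : ι → k, x ≠ 0 ∧ (∀ q ∈ S, eval x q = 0) ∧ y 0 * x i = y 1 * (a ⬝ᵥ x)}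
  have hTclosed : ∀ i, IsClosed (T i) := by
    intro i
    -- the family: `map C q` (`q ∈ S`) and `p Xᵢ - q L`
    let f₀ : MvPolynomial ι (MvPolynomial (Fin 2) k) :=
      C (X 0) * X i - ∑ j, C (X 1 * C (a j)) * X j
    let S' : Set (MvPolynomial ι (MvPolynomial (Fin 2) k)) :=
      insert f₀ ((fun q => MvPolynomial.map (C : k →+* MvPolynomial (Fin 2) k) q) '' S)
    have hS'hom : ∀ f ∈ S', ∃ d, f.IsHomogeneous d := by
      intro f hf
      rcases Set.mem_insert_iff.1 hf with rfl | ⟨q, hq, rfl⟩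
      · exact ⟨1, (isHomogeneous_C_mul_X _ _).sub
          (IsHomogeneous.sum _ _ _ fun j _ => isHomogeneous_C_mul_X _ _)⟩
      · obtain ⟨d, hd⟩ := hShom q hq
        exact ⟨d, hd.map _⟩
    have hspec0 : ∀ (y : Fin 2 → k) (x : ι → k),
        eval x (specialize y f₀) = y 0 * x i - y 1 * (a ⬝ᵥ x) := by
      intro y x
      simp only [f₀, specialize, dotProduct, map_sub, map_mul, map_sum, map_C, map_X, eval_C,
        eval_X, Finset.mul_sum]
      congr 1
      exact Finset.sum_congr rfl fun j _ => by ring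
    have hspecq : ∀ (y : Fin 2 → k), ∀ q ∈ S,
        specialize y (MvPolynomial.map (C : k →+* MvPolynomial (Fin 2) k) q) = q := by
      intro y q _
      rw [specialize, MvPolynomial.map_map]
      have : (eval y).comp (C : k →+* MvPolynomial (Fin 2) k) = RingHom.id k :=
        RingHom.ext fun r => eval_C r
      rw [this, MvPolynomial.map_id]
    have hTeq : T i =
        {y : Fin 2 → k | ∃ x : ι → k, x ≠ 0 ∧ ∀ f ∈ S', eval x (specialize y f) = 0} := by
      ext y
      constructor
      · rintro ⟨x, hx0, hxS, he⟩
        refine ⟨x, hx0, fun f hf => ?_⟩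
        rcases Set.mem_insert_iff.1 hf with rfl | ⟨q, hq, rfl⟩
        · rw [hspec0, he, sub_self]
        · rw [hspecq y q hq]
          exact hxS q hq
      · rintro ⟨x, hx0, hx⟩
        refine ⟨x, hx0, fun q hq => ?_, ?_⟩
        · have := hx _ (Set.mem_insert_of_mem _ ⟨q, hq, rfl⟩)
          rwa [hspecq y q hq] at this
        · have := hx f₀ (Set.mem_insert _ _)
          rw [hspec0] at this
          exact sub_eq_zero.1 this
    rw [hTeq]
    exact isClosed_setOf_exists_common_zero_set (k := k) (ι := ι) (σ := Fin 2) hS'hom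
  -- `(0, 1) ∉ T i`
  have hT01 : ∀ i, (![0, 1] : Fin 2 → k) ∉ T i := by
    rintro i ⟨x, hx0, hxS, he⟩
    simp only [Matrix.cons_val_zero, zero_mul, Matrix.cons_val_one, one_mul] at he
    exact hx0 (hker x ((hmemD x).2 hxS) he.symm)
  -- `T i` is stable under scalars
  have hTsmul : ∀ i (c : k) (y : Fin 2 → k), y ∈ T i → c • y ∈ T i := by
    rintro i c y ⟨x, hx0, hxS, he⟩
    refine ⟨x, hx0, hxS, ?_⟩
    simp only [Pi.smul_apply, smul_eq_mul, mul_assoc, he]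
  -- the values of the `i`-th coordinate
  have hfinT : ∀ i, {s : k | (![1, s] : Fin 2 → k) ∈ T i}.Finite := by
    intro i
    by_contra hinf
    rw [Set.not_finite] at hinf
    apply hT01 i
    obtain ⟨Q, hQ⟩ := isClosed_iff_exists_setOf_eval.1 (hTclosed i)
    have hmemT : ∀ y, y ∈ T i ↔ ∀ q ∈ Q, eval y q = 0 := fun y => by rw [hQ]; rfl
    rw [hmemT]
    intro q hq
    -- `q (c, c s) = 0` for all `c` and `s ∈ {s | (1, s) ∈ T i}` (infinite), hence identically
    have h1 : ∀ (c : k) (s : k), (![1, s] : Fin 2 → k) ∈ T i → eval ![c, c * s] q = 0 := by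
      intro c s hs
      have hcs : (![c, c * s] : Fin 2 → k) = c • ![1, s] := by
        ext j; fin_cases j <;> simp
      rw [hcs]
      exact (hmemT _).1 (hTsmul i c _ hs) q hq
    -- the substituted polynomial `q (P, P Q')` vanishes on a box with infinite sides
    let q' : MvPolynomial (Fin 2) k :=
      bind₁ (fun j : Fin 2 => if j = 0 then X 0 else X 0 * X 1) q
    have hq'eval : ∀ x : Fin 2 → k, eval x q' = eval ![x 0, x 0 * x 1] q := by
      intro x
      rw [show q' = bind₁ _ q from rfl, eval_bind₁]
      have hfg : (fun j => eval x (if j = 0 then (X 0 : MvPolynomial (Fin 2) k) else X 0 * X 1)) =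
          ![x 0, x 0 * x 1] := by
        funext j
        fin_cases j <;> simp
      rw [hfg]
    have hq'0 : q' = 0 := by
      refine MvPolynomial.funext_set
        (fun j : Fin 2 => if j = 0 then (Set.univ : Set k) else {s : k | (![1, s] : Fin 2 → k) ∈ T i})
        (fun j => ?_) fun x hx => ?_
      · fin_cases j
        · exact Set.infinite_univ
        · exact hinf
      · rw [map_zero, hq'eval]
        have hx1 : (![1, x 1] : Fin 2 → k) ∈ T i := by
          have := hx 1 (Set.mem_univ _)
          simpa using this
        exact h1 (x 0) (x 1) hx1
    -- hence `q (c, d) = 0` whenever `c ≠ 0`, so `q = 0`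
    have hq0 : q = 0 := by
      refine MvPolynomial.funext_set
        (fun j : Fin 2 => if j = 0 then {c : k | c ≠ 0} else (Set.univ : Set k))
        (fun j => ?_) fun x hx => ?_
      · fin_cases j
        · exact (Set.finite_singleton (0 : k)).infinite_compl
        · exact Set.infinite_univ
      · have hx0 : x 0 ≠ 0 := by
          have := hx 0 (Set.mem_univ _)
          simpa using this
        have hxe : x = ![x 0, x 0 * (x 1 / x 0)] := by
          ext j
          fin_cases j
          · rfl
          · simp [mul_div_cancel₀ _ hx0]
        have h2 := hq'eval ![x 0, x 1 / x 0]
        simp only [Matrix.cons_val_zero, Matrix.cons_val_one] at h2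
        rw [map_zero, hxe, ← h2, hq'0, map_zero]
    rw [hq0, map_zero]
  -- conclusion
  refine (Set.Finite.pi' fun i => hfinT i).subset ?_
  rintro w ⟨hwD, hw1⟩ i
  refine ⟨w, ?_, (hmemD w).1 hwD, ?_⟩
  · rintro rfl
    simp at hw1
  · simp [hw1]

end Finiteness

/-! ### Line stabilisers -/

section LineStabilizer

/-- The stabiliser in `G ≤ GL n k` of the line through `v` (the isotropy group of the point
`[v] ∈ ℙ(kⁿ)`; all of `G` if `v = 0`). [folklore] -/
def lineStabilizer (G : Subgroup (GL ι k)) (v : ι → k) : Subgroup (GL ι k) where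
  carrier := {g | g ∈ G ∧ ∃ c : k, (g : Matrix ι ι k) *ᵥ v = c • v}
  one_mem' := ⟨G.one_mem, 1, by simp⟩
  mul_mem' := by
    rintro g h ⟨hg, c, hc⟩ ⟨hh, d, hd⟩
    refine ⟨G.mul_mem hg hh, c * d, ?_⟩
    rw [Units.val_mul, ← Matrix.mulVec_mulVec, hd, Matrix.mulVec_smul, hc, smul_smul, mul_comm]
  inv_mem' := by
    rintro g ⟨hg, c, hc⟩
    refine ⟨G.inv_mem hg, ?_⟩
    have hinv : ((g⁻¹ : GL ι k) : Matrix ι ι k) *ᵥ ((g : Matrix ι ι k) *ᵥ v) = v := by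
      rw [Matrix.mulVec_mulVec, ← Units.val_mul, inv_mul_cancel, Units.val_one, Matrix.one_mulVec]
    by_cases hc0 : c = 0
    · refine ⟨1, ?_⟩
      rw [hc0, zero_smul] at hc
      rw [hc, Matrix.mulVec_zero] at hinv
      rw [← hinv, Matrix.mulVec_zero, smul_zero]
    · refine ⟨c⁻¹, ?_⟩
      rw [hc, Matrix.mulVec_smul] at hinv
      have := congrArg (fun w => c⁻¹ • w) hinv
      simp only [smul_smul, inv_mul_cancel₀ hc0, one_smul] at this
      exact this

/-- Membership in the line stabiliser. [folklore] -/
lemma mem_lineStabilizer_iff {G : Subgroup (GL ι k)} {v : ι → k} {g : GL ι k} :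
    g ∈ lineStabilizer G v ↔ g ∈ G ∧ ∃ c : k, (g : Matrix ι ι k) *ᵥ v = c • v := Iff.rfl

/-- The line stabiliser is contained in `G`. [folklore] -/
lemma lineStabilizer_le (G : Subgroup (GL ι k)) (v : ι → k) : lineStabilizer G v ≤ G :=
  fun _ h => h.1

/-- The line stabiliser in `G` is `G ∩` the line stabiliser in `GL n k`. [folklore] -/
lemma lineStabilizer_eq_inf (G : Subgroup (GL ι k)) (v : ι → k) :
    lineStabilizer G v = G ⊓ lineStabilizer ⊤ v := by
  ext g
  simp [mem_lineStabilizer_iff]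

omit [DecidableEq ι] in
/-- `w` is proportional to `v` iff `v = 0 = w`-coordinates-wise degenerate case, or all `2 × 2`
minors of `(w, v)` vanish. [folklore] -/
lemma exists_eq_smul_iff_minors {v : ι → k} (w : ι → k) :
    (∃ c : k, w = c • v) ↔ v = 0 ∧ (∀ i, w i = 0) ∨ v ≠ 0 ∧ ∀ i j, w i * v j = w j * v i := by
  constructor
  · rintro ⟨c, rfl⟩
    by_cases hv : v = 0
    · exact Or.inl ⟨hv, fun i => by simp [hv]⟩
    · exact Or.inr ⟨hv, fun i j => by simp only [Pi.smul_apply, smul_eq_mul]; ring⟩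
  · rintro (⟨hv, hw⟩ | ⟨hv, h⟩)
    · exact ⟨0, by funext i; simp [hw i]⟩
    · obtain ⟨j₀, hj₀⟩ : ∃ j, v j ≠ 0 := by
        by_contra hall
        push Not at hall
        exact hv (funext hall)
      refine ⟨w j₀ / v j₀, funext fun i => ?_⟩
      rw [Pi.smul_apply, smul_eq_mul, div_mul_eq_mul_div, ← h i j₀, mul_div_assoc,
        div_self hj₀, mul_one]

/-- **Line stabilisers are algebraic** (Springer 2.3.1/5.5.3: isotropy groups of points of a
projective `G`-space are closed): for `G` algebraic, `lineStabilizer G v` is an algebraic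
subgroup of `GL n k`. [folklore] -/
theorem isAlgebraicSubgroup_lineStabilizer {G : Subgroup (GL ι k)} (hG : IsAlgebraicSubgroup G)
    (v : ι → k) : IsAlgebraicSubgroup (lineStabilizer G v) := by
  rw [lineStabilizer_eq_inf]
  refine hG.inf ?_
  by_cases hv : v = 0
  · have : lineStabilizer (⊤ : Subgroup (GL ι k)) v = ⊤ := by
      ext g
      simp only [mem_lineStabilizer_iff, Subgroup.mem_top, true_and, iff_true]
      exact ⟨1, by simp [hv]⟩
    rw [this]
    exact isAlgebraicSubgroup_top
  · -- the `2 × 2` minors of `(g v, v)`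
    let row : ι → MvPolynomial (GLCoord ι) k := fun i => ∑ l, X (Sum.inl (i, l)) * C (v l)
    refine ⟨Set.range fun p : ι × ι => row p.1 * C (v p.2) - row p.2 * C (v p.1), ?_⟩
    ext g
    have hrow : ∀ i, eval (glCoordFun g) (row i) = ((g : Matrix ι ι k) *ᵥ v) i := fun i => by
      simp [row, Matrix.mulVec, dotProduct, map_sum]
    simp only [SetLike.mem_coe, mem_lineStabilizer_iff, Subgroup.mem_top, true_and, zeroLocusGL,
      Set.mem_setOf_eq, Set.forall_mem_range, map_sub, map_mul, eval_C, hrow, sub_eq_zero,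
      Prod.forall]
    rw [exists_eq_smul_iff_minors]
    simp [hv]

end LineStabilizer

/-! ### Orbit cones and closed orbits -/

section OrbitCone

variable (G : Subgroup (GL ι k)) (v : ι → k)

/-- The *orbit cone* of `v` under `G ≤ GL n k`: all multiples of all `g v`, i.e. the cone over
the orbit `G · [v]` of the line `[v] ∈ ℙ(kⁿ)` (together with `0`). [folklore] -/
def orbitCone : Set (ι → k) :=
  {w | ∃ c : k, ∃ g ∈ G, w = c • ((g : Matrix ι ι k) *ᵥ v)}

/-- The *punctured orbit cone*: non-zero multiples of the `g v`. [folklore] -/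
def orbitCone' : Set (ι → k) :=
  {w | ∃ c : k, c ≠ 0 ∧ ∃ g ∈ G, w = c • ((g : Matrix ι ι k) *ᵥ v)}

variable {G v}

/-- Membership in the orbit cone. [folklore] -/
lemma mem_orbitCone_iff {w : ι → k} :
    w ∈ orbitCone G v ↔ ∃ c : k, ∃ g ∈ G, w = c • ((g : Matrix ι ι k) *ᵥ v) := Iff.rfl

/-- Membership in the punctured orbit cone. [folklore] -/
lemma mem_orbitCone'_iff {w : ι → k} :
    w ∈ orbitCone' G v ↔ ∃ c : k, c ≠ 0 ∧ ∃ g ∈ G, w = c • ((g : Matrix ι ι k) *ᵥ v) := Iff.rfl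

/-- The orbit cone is the punctured orbit cone together with `0`. [folklore] -/
lemma orbitCone_eq_insert : orbitCone G v = insert 0 (orbitCone' G v) := by
  ext w
  simp only [mem_orbitCone_iff, Set.mem_insert_iff, mem_orbitCone'_iff]
  constructor
  · rintro ⟨c, g, hg, rfl⟩
    by_cases hc : c = 0
    · exact Or.inl (by simp [hc])
    · exact Or.inr ⟨c, hc, g, hg, rfl⟩
  · rintro (rfl | ⟨c, -, g, hg, rfl⟩)
    · exact ⟨0, 1, G.one_mem, by simp⟩
    · exact ⟨c, g, hg, rfl⟩

/-- The punctured orbit cone lies in the orbit cone. [folklore] -/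
lemma orbitCone'_subset_orbitCone : orbitCone' G v ⊆ orbitCone G v := by
  rw [orbitCone_eq_insert]
  exact Set.subset_insert _ _

/-- `v` lies in its punctured orbit cone. [folklore] -/
lemma self_mem_orbitCone' : v ∈ orbitCone' G v :=
  ⟨1, one_ne_zero, 1, G.one_mem, by simp⟩

/-- `v` lies in its orbit cone. [folklore] -/
lemma self_mem_orbitCone : v ∈ orbitCone G v :=
  orbitCone'_subset_orbitCone self_mem_orbitCone'

/-- `0` lies in the orbit cone. [folklore] -/
lemma zero_mem_orbitCone : (0 : ι → k) ∈ orbitCone G v := by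
  rw [orbitCone_eq_insert]
  exact Set.mem_insert _ _

/-- The punctured orbit cone is a cone. [folklore] -/
lemma isConeSet_orbitCone' : IsConeSet (orbitCone' G v) := by
  rintro c hc _ ⟨d, hd, g, hg, rfl⟩
  exact ⟨c * d, mul_ne_zero hc hd, g, hg, by rw [smul_smul]⟩

/-- The orbit cone is a cone. [folklore] -/
lemma isConeSet_orbitCone : IsConeSet (orbitCone G v) := by
  rintro c _ _ ⟨d, g, hg, rfl⟩
  exact ⟨c * d, g, hg, by rw [smul_smul]⟩

/-- The punctured orbit cone is `G`-stable. [folklore] -/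
lemma mulVec_mem_orbitCone' {g : GL ι k} (hg : g ∈ G) {w : ι → k} (hw : w ∈ orbitCone' G v) :
    (g : Matrix ι ι k) *ᵥ w ∈ orbitCone' G v := by
  obtain ⟨c, hc, h, hh, rfl⟩ := hw
  refine ⟨c, hc, g * h, G.mul_mem hg hh, ?_⟩
  rw [Matrix.mulVec_smul, Units.val_mul, ← Matrix.mulVec_mulVec]

/-- The orbit cone is `G`-stable. [folklore] -/
lemma mulVec_mem_orbitCone {g : GL ι k} (hg : g ∈ G) {w : ι → k} (hw : w ∈ orbitCone G v) :
    (g : Matrix ι ι k) *ᵥ w ∈ orbitCone G v := by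
  obtain ⟨c, h, hh, rfl⟩ := hw
  refine ⟨c, g * h, G.mul_mem hg hh, ?_⟩
  rw [Matrix.mulVec_smul, Units.val_mul, ← Matrix.mulVec_mulVec]

/-- A `G`-stable cone containing `v` contains its punctured orbit cone. [folklore] -/
lemma orbitCone'_subset {D : Set (ι → k)} (hD : IsConeSet D)
    (hstab : ∀ g ∈ G, ∀ w ∈ D, (g : Matrix ι ι k) *ᵥ w ∈ D) (hv : v ∈ D) : orbitCone' G v ⊆ D := by
  rintro _ ⟨c, hc, g, hg, rfl⟩
  exact hD c hc _ (hstab g hg v hv)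

/-- If two punctured orbit cones meet then each generator lies in the other cone. [folklore] -/
lemma mem_orbitCone'_of_mem_of_mem {w z : ι → k} (hzv : z ∈ orbitCone' G v)
    (hzw : z ∈ orbitCone' G w) : w ∈ orbitCone' G v := by
  obtain ⟨c, hc, g, hg, rfl⟩ := hzv
  obtain ⟨c', hc', g', hg', he⟩ := hzw
  refine ⟨c'⁻¹ * c, mul_ne_zero (inv_ne_zero hc') hc, g'⁻¹ * g, G.mul_mem (G.inv_mem hg') hg, ?_⟩
  have h1 : ((g' : GL ι k) : Matrix ι ι k) *ᵥ w = c'⁻¹ • (c • ((g : Matrix ι ι k) *ᵥ v)) := by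
    rw [he, smul_smul, inv_mul_cancel₀ hc', one_smul]
  calc w = ((g'⁻¹ : GL ι k) : Matrix ι ι k) *ᵥ (((g' : GL ι k) : Matrix ι ι k) *ᵥ w) := by
          rw [Matrix.mulVec_mulVec, ← Units.val_mul, inv_mul_cancel, Units.val_one,
            Matrix.one_mulVec]
    _ = (c'⁻¹ * c) • (((g'⁻¹ * g : GL ι k) : Matrix ι ι k) *ᵥ v) := by
          rw [h1, smul_smul, Matrix.mulVec_smul, Units.val_mul, ← Matrix.mulVec_mulVec]

variable [IsAlgClosed k]

/-- **Chevalley's theorem for orbit maps**: the punctured orbit cone of `v` under an algebraic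
`G` (the image of `G × 𝔾ₘ` under `(g, c) ↦ c g v`) contains a non-empty open subset of its
closure (Springer 1.9.5 / 2.3.3 (i): orbits are open in their closure).
[cite: SpringerLAG1998, 2.3.3 (i)] -/
theorem exists_isOpen_inter_closure_orbitCone' (hG : IsAlgebraicSubgroup G) (v : ι → k) :
    ∃ W : Set (ι → k), IsOpen W ∧ (W ∩ closure (orbitCone' G v)).Nonempty ∧
      W ∩ closure (orbitCone' G v) ⊆ orbitCone' G v := by
  classical
  -- the source `G × 𝔾ₘ ⊆ k^{(n² + 1) + 1}`
  let V : Set (GLCoord ι ⊕ Unit → k) :=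
    prodSet (glCoordFun '' (G : Set (GL ι k))) {x : Unit → k | x () ≠ 0}
  have hGcl : IsClosed (glCoordFun '' (G : Set (GL ι k))) :=
    isClosedEmbedding_glCoordFun.isClosedMap _ hG.isClosed
  have hopen : IsOpen {x : Unit → k | x () ≠ 0} := by
    have : {x : Unit → k | x () ≠ 0} = {x | eval x (X () : MvPolynomial Unit k) = 0}ᶜ := by
      ext x; simp
    rw [this]
    exact (isClosed_setOf_eval_eq_zero _).isOpen_compl
  have hV : IsLocallyClosed V := isLocallyClosed_prodSet hGcl.isLocallyClosed hopen.isLocallyClosed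
  have hVne : V.Nonempty :=
    ⟨Sum.elim (glCoordFun (1 : GL ι k)) (fun _ => 1),
      sumElim_mem_prodSet.2 ⟨⟨1, G.one_mem, rfl⟩, by simp⟩⟩
  -- the orbit map
  let φ : (GLCoord ι ⊕ Unit → k) → (ι → k) := fun z i =>
    z (Sum.inr ()) * ∑ j, z (Sum.inl (Sum.inl (i, j))) * v j
  let P : ι → MvPolynomial (GLCoord ι ⊕ Unit) k := fun i =>
    X (Sum.inr ()) * ∑ j, X (Sum.inl (Sum.inl (i, j))) * C (v j)
  have hφ : ∀ z i, φ z i = eval z (P i) := fun z i => by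
    simp [φ, P, map_sum]
  have himage : φ '' V = orbitCone' G v := by
    ext w
    simp only [Set.mem_image, mem_orbitCone'_iff]
    constructor
    · rintro ⟨z, hz, rfl⟩
      obtain ⟨⟨g, hg, hgz⟩, hz0⟩ := (mem_prodSet).1 hz
      refine ⟨z (Sum.inr ()), hz0, g, hg, funext fun i => ?_⟩
      simp only [φ, Pi.smul_apply, smul_eq_mul, Matrix.mulVec, dotProduct]
      congr 1
      refine Finset.sum_congr rfl fun j _ => ?_
      have := congrFun hgz (Sum.inl (i, j))
      rw [glCoordFun_inl] at this
      rw [← this]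
    · rintro ⟨c, hc, g, hg, rfl⟩
      refine ⟨Sum.elim (glCoordFun g) (fun _ => c),
        sumElim_mem_prodSet.2 ⟨⟨g, hg, rfl⟩, by simpa using hc⟩, funext fun i => ?_⟩
      simp [φ, Matrix.mulVec, dotProduct]
  rw [← himage]
  exact exists_isOpen_inter_closure_image_subset hV hVne P hφ

/-- **Closed orbits exist** (Springer 2.3.3 (ii), for the action of an algebraic `G ≤ GL n k`
on `ℙ(kⁿ)`, over an algebraically closed field): a closed `G`-stable cone containing a non-zero
vector contains a `v ≠ 0` whose orbit cone `{c g v}` is closed — i.e. the orbit of the line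
`[v]` is closed in `ℙ(kⁿ)`. Proof: a minimal closed `G`-stable cone `D₀ ⊆ C` with a non-zero
vector (the space is Noetherian) is the closure of the punctured orbit cone of each of its
non-zero vectors; by Chevalley (`exists_isOpen_inter_closure_orbitCone'`) any two of these
orbit cones meet, hence coincide, so `D₀ ∖ {0}` is a single punctured orbit cone.
[cite: SpringerLAG1998, 2.3.3 (ii)] -/
theorem exists_isClosed_orbitCone (hG : IsAlgebraicSubgroup G) {C : Set (ι → k)}
    (hC : IsConeSet C) (hcl : IsClosed C)
    (hstab : ∀ g ∈ G, ∀ w ∈ C, (g : Matrix ι ι k) *ᵥ w ∈ C) (hne : ∃ w ∈ C, w ≠ 0) :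
    ∃ v ∈ C, v ≠ 0 ∧ IsClosed (orbitCone G v) := by
  haveI := noetherianSpace_pi (σ := ι) (k := k)
  -- the admissible closed cones
  let 𝒮 : Set (TopologicalSpace.Closeds (ι → k)) :=
    {D | IsConeSet (D : Set (ι → k)) ∧ (∀ g ∈ G, ∀ w ∈ (D : Set (ι → k)),
      (g : Matrix ι ι k) *ᵥ w ∈ (D : Set (ι → k))) ∧ (D : Set (ι → k)) ⊆ C ∧
      ∃ w ∈ (D : Set (ι → k)), w ≠ 0}
  have hC𝒮 : (⟨C, hcl⟩ : TopologicalSpace.Closeds (ι → k)) ∈ 𝒮 := ⟨hC, hstab, le_rfl, hne⟩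
  obtain ⟨D₀, ⟨hD₀cone, hD₀stab, hD₀C, v, hvD₀, hv0⟩, hmin⟩ :=
    (wellFounded_lt (α := TopologicalSpace.Closeds (ι → k))).has_min 𝒮 ⟨_, hC𝒮⟩
  -- every non-zero vector of `D₀` has dense punctured orbit cone
  have hdense : ∀ w ∈ (D₀ : Set (ι → k)), w ≠ 0 → closure (orbitCone' G w) = (D₀ : Set (ι → k)) := by
    intro w hw hw0
    have hsub : orbitCone' G w ⊆ (D₀ : Set (ι → k)) := orbitCone'_subset hD₀cone hD₀stab hw
    have hclsub : closure (orbitCone' G w) ⊆ (D₀ : Set (ι → k)) := closure_minimal hsub D₀.isClosed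
    let E : TopologicalSpace.Closeds (ι → k) := ⟨closure (orbitCone' G w), isClosed_closure⟩
    have hE : E ∈ 𝒮 :=
      ⟨isConeSet_closure isConeSet_orbitCone',
        fun g hg z hz => mulVec_mem_closure_of_forall (fun z' hz' => mulVec_mem_orbitCone' hg hz') hz,
        hclsub.trans hD₀C, w, subset_closure self_mem_orbitCone', hw0⟩
    have hle : E ≤ D₀ := hclsub
    by_contra hne'
    exact hmin E hE (lt_of_le_of_ne hle fun h => hne' (congrArg (fun F : TopologicalSpace.Closeds (ι → k) => (F : Set (ι → k))) h))
  -- hence `D₀ ∖ {0}` is the punctured orbit cone of `v`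
  have horbit : ∀ w ∈ (D₀ : Set (ι → k)), w ≠ 0 → w ∈ orbitCone' G v := by
    intro w hw hw0
    obtain ⟨W, hW, ⟨z₀, hz₀W, hz₀⟩, hWsub⟩ := exists_isOpen_inter_closure_orbitCone' hG w
    rw [hdense w hw hw0] at hz₀ hWsub
    have hz₀v : z₀ ∈ closure (orbitCone' G v) := by rw [hdense v hvD₀ hv0]; exact hz₀
    obtain ⟨z, hzW, hzv⟩ := mem_closure_iff.1 hz₀v W hW hz₀W
    have hzD₀ : z ∈ (D₀ : Set (ι → k)) := orbitCone'_subset hD₀cone hD₀stab hvD₀ hzv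
    exact mem_orbitCone'_of_mem_of_mem hzv (hWsub ⟨hzW, hzD₀⟩)
  refine ⟨v, hD₀C hvD₀, hv0, ?_⟩
  have heq : orbitCone G v = insert 0 (D₀ : Set (ι → k)) := by
    refine Set.Subset.antisymm ?_ ?_
    · rw [orbitCone_eq_insert]
      exact Set.insert_subset_insert (orbitCone'_subset hD₀cone hD₀stab hvD₀)
    · rintro w (rfl | hw)
      · exact zero_mem_orbitCone
      · by_cases hw0 : w = 0
        · rw [hw0]
          exact zero_mem_orbitCone
        · exact orbitCone'_subset_orbitCone (horbit w hw hw0)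
  rw [heq, Set.insert_eq]
  exact (isClosed_singleton_pi 0).union D₀.isClosed

end OrbitCone

end Literature.NumberTheory.Automorphic
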